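import Literature.Computability.QuantumComplexity.ApproxMatrixProduct
import Mathlib.LinearAlgebra.Matrix.Determinant.Basic
import Mathlib.LinearAlgebra.Matrix.Symmetric
import HarnessLib

/-!
# Barrier catalogue `QuantumAdvantage` — quantum-inspired (SQ-access) classical algorithms cannot
# solve sparse well-conditioned linear systems with polylogarithmically many queries (Grønlund–Larsen)

Topic `Literature/Barriers/QuantumAdvantage` (D-0021).  Source read: A. Grønlund, K. G. Larsen,
*An Exponential Separation Between Quantum and Quantum-Inspired Classical Algorithms for Linear
Systems*, arXiv:2411.02087 (v5, 2 Dec 2025; held text `paper:arxiv-2411.02087`), verbatim: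

> **Definition 1 (Query Access).** For a vector `v ∈ ℝⁿ`, we have `Q(v)`, query access to `v`, if
> for all `i`, we can query `v_i`. Likewise for a matrix `M ∈ ℝ^{m×n}`, we have query access to
> `M` if for all `(i,j) ∈ [m]×[n]`, we can query `M_{i,j}`.
> **Definition 2 (Sampling and Query Access to a Vector).** For a vector `v ∈ ℝⁿ`, we have
> `SQ(v)`, sampling and query access to `v`, if we can • Query for entries of `v` as in `Q(v)`.
> • Obtain independent samples of indices `i ∈ [n]`, each distributed as `P[i] = v_i²/‖v‖²`.
> • Query for `‖v‖`.
> **Definition 3 (Sampling and Query Access to a Matrix).** For a matrix `M ∈ ℝ^{m×n}`, we have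
> `SQ(M)` if we have `SQ(M_{i,⋆})`, `SQ(M_{⋆,j})`, `SQ(r)` and `SQ(c)` for all `i ∈ m` and `j ∈ n`
> where `r(M) = (‖M_{1,⋆}‖, …, ‖M_{m,⋆}‖)` and `c(M) = (‖M_{⋆,1}‖, …, ‖M_{⋆,n}‖)`.
> **Problem 1 (Linear Systems).** Given `SQ(M)` and `SQ(y)` for a symmetric and real matrix
> `M ∈ ℝ^{n×n}` of full rank, a vector `y ∈ ℝⁿ` and precision `ε > 0`, the Linear Systems problem
> is to support sampling an index `i` with probability `x̃_i²/‖x̃‖²` from a vector `x̃` satisfying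
> that `‖x̃ − x‖ ≤ ε‖x‖` where `x = M⁻¹y` is the solution to the linear system of equations `Mx = y`.
> The query complexity of a QIC algorithm for solving a linear system, is the number of queries to
> `SQ(M)` and `SQ(y)` necessary to sample one index `i` from `x̃`.
> **Theorem 1.** There is a constant `c ≥ 1`, such that for any integers `n, k ≥ c`, it holds for
> any QIC algorithm `𝒜` with precision `ε ≤ 2^{−ck}` for linear systems, that there exists a full
> rank `n × n` symmetric real matrix `M` with condition number `κ ≤ c ln n` and `3`-sparse rows
> and columns, such that `𝒜` must make `c^{−1} n^{1−1/k}` queries to `SQ(M)` on the linear system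
> `Mx = e_1`.

BARRIER: technique_class := quantum-inspired classical (QIC) algorithms in the sense of Tang —
  classical randomized procedures whose only access to the input `M ∈ ℝ^{n×n}`, `y ∈ ℝⁿ` is
  sampling-and-query access `SQ(M)`, `SQ(y)` (entries, `ℓ²`-samples from rows / columns / the
  row- and column-norm vectors, norms) [cite: GronlundLarsen2024, §1.1 Defs. 1–3 and Problem 1],
  "any state preparation assumptions in the quantum machine learning model should be matched with
  `ℓ²`-norm sampling assumptions in the classical machine learning model" [cite: GronlundLarsen2024, §1.1 (quoting Tang)];
  formalized below as the adaptive randomized query trees `QIC.Alg n` over the oracle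
  `QIC.answer` (the tree's `SampleQuery.lengthSqDist` / `rowDist` / `normSq` / `frobSq` of
  `Literature/Computability/QuantumComplexity/SampleQueryAccess.lean` are the sampling laws);
  blocks := an `SQ`-access DEQUANTIZATION (polylog-query classical counterpart) of quantum linear
  system solvers for SPARSE, WELL-CONDITIONED systems — the regime of CLAIMS row A-02 (HHL /
  Childs–Kothari–Somma / Costa et al.): the best quantum algorithm uses
  `O(κ ln(1/ε) min{s, √s (κs/ε)^{o(1)}})` = `ln(n) ln ln n` queries for `s = 3`, `κ ≤ c ln n`,
  constant `ε`, while every QIC algorithm needs `c^{−1} n^{1−1/k}` [cite: GronlundLarsen2024, §1.1 Thm 1 and eq. (1)];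
  "the lower bound holds even for a constant precision `ε`" and "also holds in the well-studied
  sparse access model" [cite: GronlundLarsen2024, §1.1 (remarks after Thm 1)];
  because := reductions from two classical query lower bounds: (a) the glued-trees random-walk game
  of Childs et al. — "Any classical algorithm that queries `O` at most `2^{n/6}` times wins with
  probability at most `4 · 2^{−n/6}`" (in tree, PROVED: `Literature.Computability.QuantumComplexity.GluedTrees.ChildsEtAl2003_thm9_holds`)
  — an efficient QIC linear-system solver on `M = λI − A(G_n)` (padded), `y = e_1`, would sample
  the EXIT root with probability `Ω(n^{−5})` [cite: GronlundLarsen2024, §2 Thm 2, Lemmas 1–2, §2.1];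
  this gives Thm 1 "with slightly worse parameters" (`κ ≤ c ln² n`, `ε ≤ (c ln^{2.5} n)^{−1}`,
  `4`-sparse, `Ω(n^{1/12})` queries) [cite: GronlundLarsen2024, §2.1 (last paragraph)]; (b) the
  randomized query lower bound `Ω((2ⁿ/n)^{1−1/k})` for `k`-Forrelation, encoded as a sparse
  well-conditioned block matrix whose inverse applied to `e_1` concentrates on the Forrelation
  value [cite: GronlundLarsen2024, §3 (k-Forrelation, eqs. (7)–(8)) and §3 end ("This gives us our main result in Theorem 1")];
  evasions_known := input regimes OUTSIDE the theorem: low-rank / large-`κ_F`-budget inputs, where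
  QIC algorithms DO solve linear systems in `poly(s, κ_F, ln(1/ε), ln n)` queries [cite: GronlundLarsen2024, §1.1 eq. (2) (Shao–Montanaro)]
  and the `SQ` road of Chia–Gilyén–Li–Lin–Tang–Wang is complete for `κ_F`-bounded instances
  [cite: ChiaEtAl2022, §1.3 (Key lemma) and §6]; sparse-access eigenvalue ESTIMATION to constant
  precision with a guiding vector (Gharibian–Le Gall), "not quite sampling from `M⁻¹v` but
  reasonably close", which "suggests that to achieve an exponential separation … we probably need
  to consider `κ` that is at least logarithmic in `n`" [cite: GronlundLarsen2024, §1.1 (paragraph on Gharibian–Le Gall)]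
  [cite: GharibianLegall2022, Thm 1]; inputs given as a short binary ENCODING rather than by
  `SQ` access (then classical hardness is only CONDITIONAL, via BQP-completeness of sparse
  well-conditioned linear systems) [cite: GronlundLarsen2024, §1.1 ("Previous Hardness of Solving Linear Systems")];
  scope_caveats := (i) a QUERY lower bound in the `SQ(M)`/`SQ(y)` model for ONE task (Problem 1:
  sampling from `x̃` with `‖x̃ − x‖ ≤ ε‖x‖`, `y = e_1`), for `n, k ≥ c` with an unspecified
  absolute constant `c` and `ε ≤ 2^{−ck}` — it says nothing about inputs that are not accessed
  through `SQ`, about low-rank or `κ_F`-bounded inputs, or about BQP vs BPP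
  [cite: GronlundLarsen2024, §1.1 Thm 1]; (ii) "must make … queries" is read below as a bound on
  the WORST-CASE number of queries over the algorithm's positive-probability runs on the input
  `(M, e_1)` (`QIC.QueryBound`), the reading under which the printed reductions (which invoke
  worst-case query bounds, Thm 2) operate; an expected-query-count version is NOT stated
  [cite: GronlundLarsen2024, §2 Thm 2 and §2.1]; (iii) the printed hypothesis "QIC algorithm with
  precision `ε` for linear systems" is rendered as correctness on ALL instances of Problem 1 of
  dimension `n` (`QIC.Solves`; the proof only uses the hard family, so the statement below is the
  printed one, not the strongest the proof gives); (iv) the source is a preprint (arXiv v5, 2 Dec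
  2025; no proceedings/journal record located on 2026-08-20 — Crossref and arXiv answered,
  OpenAlex/Semantic Scholar rate-limited) [cite: GronlundLarsen2024, (arXiv record)];
  status := established (preprint theorem resting on published lower bounds, one of them proved
  in tree as `ChildsEtAl2003_thm9_holds`; no published dissent located) [cite: GronlundLarsen2024, §2–§3].

## Lean rendering (the QIC model, D-0021 "technique class as an explicit Lean definition")

* `QIC.Query n` — the twelve oracle calls of Defs. 1–3 for an `n × n` matrix `M` and a vector `y`
  (entry `M_{ij}`; norms of rows, of columns, of `r(M)`, of `c(M)`; `ℓ²`-samples from a row, a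
  column, `r(M)`, `c(M)`; entry / norm / sample of `y`); `QIC.answer M y q` — the oracle's reply:
  a real number, or the law of a random index (`SampleQuery.lengthSqDist`, `rowDist`).
* `QIC.Alg n` — a QIC algorithm as an adaptive randomized query tree (leaves output the sampled
  index; `coin p` nodes are the algorithm's own randomness; `query q k` continues with `k r` on
  reply `r`).  `QIC.outProb M y A i` — the probability that `A` outputs `i` on input `(M, y)`;
  `QIC.QueryBound M y A T` — every positive-probability run of `A` on `(M, y)` makes at most `T`
  queries; `QIC.Solves ε A` — `A` has precision `ε` for linear systems (Problem 1, all symmetric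
  full-rank `M`, `y ≠ 0`: the output law is `𝒟_x̃` for some `x̃` with `‖x̃ − x‖ ≤ ε‖x‖`, `Mx = y`).
* `GronlundLarsen2025_qicLinearSystems_lowerBound : Prop` — Theorem 1 (the ONE named fact of
  this file; condition number rendered as `σ ≤ ‖Mx‖/‖x‖ ≤ (c ln n)σ` for some `σ > 0`, i.e.
  `σ_max/σ_min ≤ c ln n`; `e_1` the first standard unit vector).
* Proved API (sanity of the model, no content of the theorem): `outProb` of a well-formed
  algorithm is a probability vector whenever every sampling law met is one (`sum_outProb_eq_one`,
  `outProb_nonneg`), `QueryBound` is monotone in the budget (`QueryBound.mono`), a leaf makes no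
  query (`queryBound_output`).

Relation to the tree's oracle-machine vocabulary: `Literature.Computability.Complexity.OracleAlg`
(deterministic transcripts against a deterministic Boolean oracle, used by `GluedTrees.lean`) does
not carry stochastic replies; the `SQ` oracle's sample calls are random, whence the tree model here.
Not proved here: Theorem 1 itself (route: `ChildsEtAl2003_thm9_holds` + the spectral Lemmas 1–2 of
§2 would give the weak-parameter version).  One named fact; no other unproved declaration.

## References
* [GronlundLarsen2024] A. Grønlund, K. G. Larsen, arXiv:2411.02087v5 (2 Dec 2025), §1.1
  (Defs. 1–3, Problem 1, eqs. (1)–(2), Theorem 1), §2 (Thm 2 = Childs et al., Lemmas 1–2, §2.1),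
  §3 (k-Forrelation reduction).
* [ChildsEtAl2003] A. M. Childs et al., STOC 2003 (arXiv:quant-ph/0209131), Thm 9 — in tree,
  `Literature/Computability/QuantumComplexity/GluedTrees*.lean`.
* [ChiaEtAl2022] N.-H. Chia et al., J. ACM 69(5):33 (arXiv:1910.06151) — the SQ road.
* [GharibianLegall2022] S. Gharibian, F. Le Gall, STOC 2022 (arXiv:2111.09079), Thm 1.
-/

noncomputable section

namespace Literature.Barriers.QuantumAdvantage

namespace QIC

open Finset Literature.Computability.QuantumComplexity.SampleQuery

open scoped Matrix

variable {n : ℕ}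

/-! ### Definitions 1–3: the `SQ(M)`, `SQ(y)` oracle -/

/-- The oracle calls available to a QIC algorithm on input `(M ∈ ℝ^{n×n}, y ∈ ℝⁿ)`: `Q(M)` entries;
the norms `‖M_{i,⋆}‖`, `‖M_{⋆,j}‖`, `‖r(M)‖`, `‖c(M)‖`; `ℓ²`-samples from `M_{i,⋆}`, `M_{⋆,j}`,
`r(M)`, `c(M)`; and `SQ(y)`: entries, `‖y‖`, samples. [cite: GronlundLarsen2024, §1.1 Defs. 1–3] -/
inductive Query (n : ℕ) : Type
  | entry (i j : Fin n)
  | rowNorm (i : Fin n)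
  | colNorm (j : Fin n)
  | rowNormsNorm
  | colNormsNorm
  | sampleRow (i : Fin n)
  | sampleCol (j : Fin n)
  | sampleRowNorms
  | sampleColNorms
  | vecEntry (i : Fin n)
  | vecNorm
  | vecSample

/-- A reply of the oracle: a real number (entry / norm queries) or an index (sample queries).
[cite: GronlundLarsen2024, §1.1 Defs. 1–3] -/
abbrev Response (n : ℕ) : Type := ℝ ⊕ Fin n

/-- The oracle's answer to a call on input `(M, y)`: `Sum.inl a` = the deterministic real reply
`a`; `Sum.inr d` = a random index with law `d` (`P[i] = v_i²/‖v‖²` for the relevant vector `v`: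
a row, a column, `r(M)`, `c(M)` or `y`). [cite: GronlundLarsen2024, §1.1 Defs. 1–3] -/
def answer (M : Matrix (Fin n) (Fin n) ℝ) (y : Fin n → ℝ) : Query n → ℝ ⊕ (Fin n → ℝ)
  | .entry i j => .inl (M i j)
  | .rowNorm i => .inl (Real.sqrt (normSq (M i)))
  | .colNorm j => .inl (Real.sqrt (normSq (Mᵀ j)))
  | .rowNormsNorm => .inl (Real.sqrt (frobSq M))
  | .colNormsNorm => .inl (Real.sqrt (frobSq Mᵀ))
  | .sampleRow i => .inr (lengthSqDist (M i))
  | .sampleCol j => .inr (lengthSqDist (Mᵀ j))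
  | .sampleRowNorms => .inr (rowDist M)
  | .sampleColNorms => .inr (rowDist Mᵀ)
  | .vecEntry i => .inl (y i)
  | .vecNorm => .inl (Real.sqrt (normSq y))
  | .vecSample => .inr (lengthSqDist y)

/-! ### QIC algorithms: adaptive randomized query trees -/

/-- A quantum-inspired classical algorithm for an `n`-dimensional linear system, as an adaptive
randomized query tree: `output i` ends the run with the sampled index `i`; `coin p t f` continues
with `t` with probability `p` and with `f` otherwise (internal randomness); `query q k` calls the
oracle with `q` and continues with `k r` on reply `r`. [cite: GronlundLarsen2024, §1.1 (QIC
algorithms; "the number of queries to `SQ(M)` and `SQ(y)` necessary to sample one index")] -/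
inductive Alg (n : ℕ) : Type
  | output (i : Fin n) : Alg n
  | coin (p : ℝ) (t f : Alg n) : Alg n
  | query (q : Query n) (k : Response n → Alg n) : Alg n

/-- Well-formedness: every coin bias lies in `[0,1]`. [cite: GronlundLarsen2024, §1.1 (QIC
algorithms are classical randomized algorithms)] -/
def IsProb : Alg n → Prop
  | .output _ => True
  | .coin p t f => 0 ≤ p ∧ p ≤ 1 ∧ IsProb t ∧ IsProb f
  | .query _ k => ∀ r, IsProb (k r)

/-- The output law: `outProb M y A i` = probability that `A`, run against the oracle of `(M, y)`,
outputs the index `i` (deterministic replies are followed; sample replies are averaged over their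
law; coins over their bias). [cite: GronlundLarsen2024, §1.1 Problem 1 ("sampling an index `i`
with probability `x̃_i²/‖x̃‖²`")] -/
def outProb (M : Matrix (Fin n) (Fin n) ℝ) (y : Fin n → ℝ) : Alg n → Fin n → ℝ
  | .output i => fun j => if j = i then 1 else 0
  | .coin p t f => fun j => p * outProb M y t j + (1 - p) * outProb M y f j
  | .query q k => fun j =>
      match answer M y q with
      | .inl a => outProb M y (k (.inl a)) j
      | .inr d => ∑ r, d r * outProb M y (k (.inr r)) j

/-- `QueryBound M y A T`: on input `(M, y)` every run of `A` that has positive probability (sample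
replies in the support of their law; both sides of every coin) makes at most `T` oracle calls —
"`𝒜` makes `T` queries to `SQ(M)` [and `SQ(y)`]". [cite: GronlundLarsen2024, §1.1 (query
complexity of a QIC algorithm) and §2.1 ("a QIC algorithm … that makes `T(M, ε)` queries")] -/
def QueryBound (M : Matrix (Fin n) (Fin n) ℝ) (y : Fin n → ℝ) : Alg n → ℕ → Prop
  | .output _, _ => True
  | .coin _ t f, T => QueryBound M y t T ∧ QueryBound M y f T
  | .query q k, T =>
      0 < T ∧
        match answer M y q with
        | .inl a => QueryBound M y (k (.inl a)) (T - 1)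
        | .inr d => ∀ r, 0 < d r → QueryBound M y (k (.inr r)) (T - 1)

/-- **Problem 1 / "precision `ε` for linear systems"**: `A` is well formed and, for every symmetric
real full-rank `M ∈ ℝ^{n×n}` and every `y ≠ 0`, with `x` the solution of `Mx = y`, the output law
of `A` on `(M, y)` is `𝒟_x̃` (`i ↦ x̃_i²/‖x̃‖²`) for some `x̃` with `‖x̃ − x‖ ≤ ε‖x‖`.
[cite: GronlundLarsen2024, §1.1 Problem 1] -/
def Solves (ε : ℝ) (A : Alg n) : Prop :=
  IsProb A ∧
    ∀ (M : Matrix (Fin n) (Fin n) ℝ) (y x : Fin n → ℝ), M.IsSymm → M.det ≠ 0 → y ≠ 0 →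
      M.mulVec x = y →
        ∃ xt : Fin n → ℝ, Real.sqrt (normSq (xt - x)) ≤ ε * Real.sqrt (normSq x) ∧
          outProb M y A = lengthSqDist xt

/-- The right-hand side `e_1` (first standard unit vector). [cite: GronlundLarsen2024, §1.1
Thm 1 ("on the linear system `Mx = e_1`")] -/
def e1 (n : ℕ) : Fin n → ℝ := fun i => if (i : ℕ) = 0 then 1 else 0

/-! ### The barrier (one named fact) -/

/-- **Grønlund–Larsen, Theorem 1 (exponential separation for linear systems in the SQ model).**
There is a constant `c ≥ 1` such that for all integers `n, k ≥ c`, every QIC algorithm `A` with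
precision `ε ≤ 2^{−ck}` for `n`-dimensional linear systems admits a full-rank symmetric real
`M ∈ ℝ^{n×n}` with condition number `σ_max/σ_min ≤ c ln n` (rendered: `σ‖x‖ ≤ ‖Mx‖ ≤ (c ln n)σ‖x‖`
for some `σ > 0`) and at most `3` non-zero entries in every row and every column, on which — with
right-hand side `e_1` — `A` must make at least `c^{−1} n^{1−1/k}` queries: every budget `T`
bounding all its positive-probability runs satisfies `T ≥ n^{1−1/k}/c`.
[cite: GronlundLarsen2024, §1.1 Theorem 1] -/
def GronlundLarsen2025_qicLinearSystems_lowerBound : Prop :=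
  ∃ c : ℝ, 1 ≤ c ∧
    ∀ (n k : ℕ), c ≤ n → c ≤ k →
      ∀ (ε : ℝ) (A : Alg n), 0 < ε → ε ≤ (2 : ℝ) ^ (-(c * k)) → Solves ε A →
        ∃ M : Matrix (Fin n) (Fin n) ℝ,
          M.IsSymm ∧ M.det ≠ 0 ∧
          (∃ σ : ℝ, 0 < σ ∧ ∀ x : Fin n → ℝ,
              σ ^ 2 * normSq x ≤ normSq (M.mulVec x) ∧
                normSq (M.mulVec x) ≤ (c * Real.log n) ^ 2 * σ ^ 2 * normSq x) ∧
          (∀ i, (univ.filter fun j => M i j ≠ 0).card ≤ 3) ∧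
          (∀ j, (univ.filter fun i => M i j ≠ 0).card ≤ 3) ∧
          ∀ T : ℕ, QueryBound M (e1 n) A T → (n : ℝ) ^ (1 - 1 / (k : ℝ)) / c ≤ T

/-! ### Proved API: the model behaves as a randomized query algorithm -/

/-- A leaf makes no query. [cite: GronlundLarsen2024, §1.1 (query complexity)] -/
@[simp] theorem queryBound_output (M : Matrix (Fin n) (Fin n) ℝ) (y : Fin n → ℝ) (i : Fin n)
    (T : ℕ) : QueryBound M y (.output i) T := by
  simp only [QueryBound]

/-- A query node needs a positive budget. [cite: GronlundLarsen2024, §1.1 (query complexity)] -/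
theorem not_queryBound_query_zero (M : Matrix (Fin n) (Fin n) ℝ) (y : Fin n → ℝ)
    (q : Query n) (k : Response n → Alg n) : ¬ QueryBound M y (.query q k) 0 := by
  simp only [QueryBound, lt_self_iff_false, false_and, not_false_eq_true]

/-- **Monotonicity of the budget**: a run bounded by `T` queries is bounded by any `T' ≥ T`.
[cite: GronlundLarsen2024, §1.1 (query complexity)] -/
theorem QueryBound.mono {M : Matrix (Fin n) (Fin n) ℝ} {y : Fin n → ℝ} {A : Alg n} :
    ∀ {T T' : ℕ}, T ≤ T' → QueryBound M y A T → QueryBound M y A T' := by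
  induction A with
  | output i => intro T T' _ _; simp only [QueryBound]
  | coin p t f iht ihf =>
      intro T T' hT h
      simp only [QueryBound] at h ⊢
      exact ⟨iht hT h.1, ihf hT h.2⟩
  | query q k ih =>
      intro T T' hT h
      simp only [QueryBound] at h ⊢
      refine ⟨lt_of_lt_of_le h.1 hT, ?_⟩
      have h2 := h.2
      have hT1 : T - 1 ≤ T' - 1 := Nat.sub_le_sub_right hT 1
      rcases hq : answer M y q with a | d
      · rw [hq] at h2
        dsimp only at h2 ⊢
        exact ih _ hT1 h2
      · rw [hq] at h2
        dsimp only at h2 ⊢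
        exact fun r hr => ih _ hT1 (h2 r hr)

/-- **The output law is nonnegative** for a well-formed algorithm whenever every sampling law it
can meet is nonnegative. [cite: GronlundLarsen2024, §1.1 Problem 1] -/
theorem outProb_nonneg {M : Matrix (Fin n) (Fin n) ℝ} {y : Fin n → ℝ}
    (hlaw : ∀ q d, answer M y q = .inr d → ∀ r, 0 ≤ d r) {A : Alg n} :
    IsProb A → ∀ j, 0 ≤ outProb M y A j := by
  induction A with
  | output i => intro _ j; simp only [outProb]; split_ifs <;> norm_num
  | coin p t f iht ihf =>
      intro h j
      obtain ⟨hp0, hp1, ht, hf⟩ := h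
      simp only [outProb]
      have := iht ht j
      have := ihf hf j
      nlinarith
  | query q k ih =>
      intro h j
      simp only [outProb]
      rcases hq : answer M y q with a | d
      · dsimp only
        exact ih _ (h (.inl a)) j
      · dsimp only
        exact sum_nonneg fun r _ => mul_nonneg (hlaw q d hq r) (ih _ (h (.inr r)) j)

/-- **The output law is a probability vector**: for a well-formed algorithm, if every sampling law
it can meet sums to one, then `Σ_i outProb M y A i = 1` (leaves are point masses, coins and sample
nodes are convex combinations). [cite: GronlundLarsen2024, §1.1 Problem 1 ("support sampling an
index `i`")] -/
theorem sum_outProb_eq_one {M : Matrix (Fin n) (Fin n) ℝ} {y : Fin n → ℝ}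
    (hlaw : ∀ q d, answer M y q = .inr d → ∑ r, d r = 1) {A : Alg n} :
    IsProb A → ∑ j, outProb M y A j = 1 := by
  induction A with
  | output i => intro _; simp [outProb]
  | coin p t f iht ihf =>
      intro h
      obtain ⟨-, -, ht, hf⟩ := h
      simp only [outProb, sum_add_distrib, ← mul_sum, iht ht, ihf hf]
      ring
  | query q k ih =>
      intro h
      simp only [outProb]
      rcases hq : answer M y q with a | d
      · dsimp only
        exact ih _ (h (.inl a))
      · dsimp only
        rw [sum_comm]
        have : ∀ r, ∑ j, d r * outProb M y (k (.inr r)) j = d r := fun r => by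
          rw [← mul_sum, ih _ (h (.inr r)), mul_one]
        simp_rw [this]
        exact hlaw q d hq

/-- On a VALID instance (`M` of full rank, `y ≠ 0`) every sampling law of the oracle is a
probability vector: rows and columns of a full-rank matrix are nonzero, and so are `r(M)`, `c(M)`,
`y`. [cite: GronlundLarsen2024, §1.1 Defs. 2–3 with Problem 1] -/
theorem answer_law_sum_eq_one {M : Matrix (Fin n) (Fin n) ℝ} {y : Fin n → ℝ} (hM : M.det ≠ 0)
    (hy : y ≠ 0) (q : Query n) (d : Fin n → ℝ) (hq : answer M y q = .inr d) : ∑ r, d r = 1 := by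
  -- rows / columns of `M` are nonzero, hence so are `M`, `Mᵀ` and their row-norm vectors
  have hrow : ∀ i, M i ≠ 0 := fun i h0 =>
    hM (Matrix.det_eq_zero_of_row_eq_zero i fun j => congrFun h0 j)
  have hcol : ∀ j, Mᵀ j ≠ 0 := fun j h0 => by
    apply hM
    rw [← Matrix.det_transpose]
    exact Matrix.det_eq_zero_of_row_eq_zero j fun i => congrFun h0 i
  obtain ⟨i0, -⟩ := Function.ne_iff.mp hy
  have hne : ∀ (B : Matrix (Fin n) (Fin n) ℝ), (∀ i, B i ≠ 0) → rowNorms B ≠ 0 := by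
    intro B hB h0
    have h1 : normSq (rowNorms B) = 0 := by rw [h0]; exact (normSq_eq_zero_iff _).2 rfl
    rw [normSq_rowNorms] at h1
    have h2 : normSq (B i0) ≤ frobSq B :=
      Finset.single_le_sum (f := fun i => normSq (B i)) (fun i _ => normSq_nonneg _) (mem_univ i0)
    rw [h1] at h2
    exact hB i0 ((normSq_eq_zero_iff _).1 (le_antisymm h2 (normSq_nonneg _)))
  cases q <;> simp only [answer, Sum.inr.injEq, reduceCtorEq] at hq <;> subst hq
  · exact sum_lengthSqDist (hrow _)
  · exact sum_lengthSqDist (hcol _)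
  · rw [← lengthSqDist_rowNorms]; exact sum_lengthSqDist (hne M hrow)
  · rw [← lengthSqDist_rowNorms]; exact sum_lengthSqDist (hne Mᵀ hcol)
  · exact sum_lengthSqDist hy

/-! ### Problem 1 on a promise class (definition; no new fact)

Theorem 1 is printed for QIC algorithms that solve Problem 1 on ALL symmetric full-rank inputs
(`Solves`), but its proof — and the remark "the lower bound holds even for a constant precision
`ε`", "also holds in the well-studied sparse access model" — only ever runs the algorithm on the
hard instances, which satisfy an explicit promise (`3`-sparse rows and columns, condition number
`κ ≤ c ln n`, right-hand side `e_1`; §2.1: "`‖M‖ ≤ 6`", "`σ_min ≥ γ`").  The promise-class form of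
Problem 1 below is the correctness notion such a run needs: the same exact output law, demanded
only on the inputs of a class `𝒞`.  It is a DEFINITION (used by lines that pair an upper bound on
a promise class with this barrier); `Solves` is the case `𝒞 = everything`. -/

/-- **Problem 1 restricted to a promise class.** `SolvesOn 𝒞 ε A`: `A` is well formed and, for
every input `(M, y)` IN THE CLASS `𝒞` with `M` symmetric of full rank and `y ≠ 0`, the output law
of `A` on `(M, y)` is `𝒟_x̃` for some `x̃` with `‖x̃ − x‖ ≤ ε‖x‖`, `Mx = y` — Problem 1 verbatim with
its input quantifier restricted to `𝒞` (e.g. `𝒞` = "`s`-sparse rows and columns, `‖M‖ ≤ 1`,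
`σ_min(M) ≥ 1/κ`", the promise under which Theorem 1's instances live).
[cite: GronlundLarsen2024, §1.1 Problem 1 and Thm 1 ("`3`-sparse rows and columns", "condition number `κ ≤ c ln n`")] -/
def SolvesOn (𝒞 : Set (Matrix (Fin n) (Fin n) ℝ × (Fin n → ℝ))) (ε : ℝ) (A : Alg n) : Prop :=
  IsProb A ∧
    ∀ (M : Matrix (Fin n) (Fin n) ℝ) (y x : Fin n → ℝ), (M, y) ∈ 𝒞 → M.IsSymm → M.det ≠ 0 → y ≠ 0 →
      M.mulVec x = y →
        ∃ xt : Fin n → ℝ, Real.sqrt (normSq (xt - x)) ≤ ε * Real.sqrt (normSq x) ∧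
          outProb M y A = lengthSqDist xt

/-- `Solves` is `SolvesOn` the class of all inputs. [cite: GronlundLarsen2024, §1.1 Problem 1] -/
theorem solves_iff_solvesOn_univ (ε : ℝ) (A : Alg n) : Solves ε A ↔ SolvesOn Set.univ ε A := by
  simp only [Solves, SolvesOn, Set.mem_univ, forall_const]

/-- A solver of Problem 1 solves it on every promise class. [cite: GronlundLarsen2024, §1.1 Problem 1] -/
theorem Solves.solvesOn {ε : ℝ} {A : Alg n} (h : Solves ε A)
    (𝒞 : Set (Matrix (Fin n) (Fin n) ℝ × (Fin n → ℝ))) : SolvesOn 𝒞 ε A :=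
  ⟨h.1, fun M y x _ hM hdet hy hx => h.2 M y x hM hdet hy hx⟩

/-- `SolvesOn` is antitone in the class: correctness on a larger class gives correctness on a
smaller one. [cite: GronlundLarsen2024, §1.1 Problem 1] -/
theorem SolvesOn.anti {𝒞 𝒞' : Set (Matrix (Fin n) (Fin n) ℝ × (Fin n → ℝ))} (h𝒞 : 𝒞 ⊆ 𝒞') {ε : ℝ}
    {A : Alg n} (h : SolvesOn 𝒞' ε A) : SolvesOn 𝒞 ε A :=
  ⟨h.1, fun M y x hmem hM hdet hy hx => h.2 M y x (h𝒞 hmem) hM hdet hy hx⟩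

/-- `SolvesOn` is monotone in the precision. [cite: GronlundLarsen2024, §1.1 Problem 1 ("precision `ε > 0`")] -/
theorem SolvesOn.mono_eps {𝒞 : Set (Matrix (Fin n) (Fin n) ℝ × (Fin n → ℝ))} {ε ε' : ℝ} (hε : ε ≤ ε')
    {A : Alg n} (h : SolvesOn 𝒞 ε A) : SolvesOn 𝒞 ε' A := by
  refine ⟨h.1, fun M y x hmem hM hdet hy hx => ?_⟩
  obtain ⟨xt, hxt, hlaw⟩ := h.2 M y x hmem hM hdet hy hx
  exact ⟨xt, le_trans hxt (mul_le_mul_of_nonneg_right hε (Real.sqrt_nonneg _)), hlaw⟩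

/-- Theorem 1 with `Solves` replaced by `SolvesOn 𝒞` for any class `𝒞` CONTAINING the instances
it produces is a formally stronger statement implying the catalogued fact; conversely the fact
as typed is its `𝒞 = univ` case.  Recorded as the `univ` direction only (no new fact).
[cite: GronlundLarsen2024, §1.1 Thm 1] -/
theorem GronlundLarsen2025_qicLinearSystems_lowerBound_iff_univ :
    GronlundLarsen2025_qicLinearSystems_lowerBound ↔
      ∃ c : ℝ, 1 ≤ c ∧
        ∀ (n k : ℕ), c ≤ n → c ≤ k →
          ∀ (ε : ℝ) (A : Alg n), 0 < ε → ε ≤ (2 : ℝ) ^ (-(c * k)) → SolvesOn Set.univ ε A →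
            ∃ M : Matrix (Fin n) (Fin n) ℝ,
              M.IsSymm ∧ M.det ≠ 0 ∧
              (∃ σ : ℝ, 0 < σ ∧ ∀ x : Fin n → ℝ,
                  σ ^ 2 * normSq x ≤ normSq (M.mulVec x) ∧
                    normSq (M.mulVec x) ≤ (c * Real.log n) ^ 2 * σ ^ 2 * normSq x) ∧
              (∀ i, (univ.filter fun j => M i j ≠ 0).card ≤ 3) ∧
              (∀ j, (univ.filter fun i => M i j ≠ 0).card ≤ 3) ∧
              ∀ T : ℕ, QueryBound M (e1 n) A T → (n : ℝ) ^ (1 - 1 / (k : ℝ)) / c ≤ T := by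
  simp only [GronlundLarsen2025_qicLinearSystems_lowerBound, solves_iff_solvesOn_univ]

end QIC

end Literature.Barriers.QuantumAdvantage

end
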